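import Summits.Ventures.PercRepro.Night2ThreeTwoMissedSources

/-!
# PercRepro — the cell `(3, 2)`: the column bound of the missed-point routing at the large targets (night-2, gen 25)

A target `S` of the missed-point routing (`Night2LocalRuleMissed`, `Night2ThreeTwoMissedSources`) receives at most
`1/20` from each of its sources and keeps `cap2 ≥ 11/60` as soon as it has one, so the column bound `dload S ≤ cap2 S`
holds wherever `S` has at most three sources.  This module proves it for every target with `|S ∖ K| ≥ 8` by the
COMMON-LINE argument:

* `inter_subset_of_sources`: three sources `B, B', B''` of a target with `|S ∖ K| ≥ 8` (`B ≠ B'`) satisfy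
  `B ∩ B' ⊆ B''` — the sets `(B ∩ B') ∖ K` and `(B ∩ B'') ∖ K` have rank `≤ 2` and share `≥ |S ∖ K| − 6 ≥ 2` points, so
  the first lies in `cl B''`, whose trace on `S` is `B''`;
* `card_le_three_of_inter_subset`: a family of co-pairs of `S` with that property has at most three members (the
  co-pairs lie in the union of two of them: either that union has three points, or two co-pairs are disjoint and a
  third would have to equal one of them);
* `card_missedSources_le_three`: at most three sources at a large target;
* **`dload_missed_le_cap2_of_eight_le`**: `dload S ≤ 3/20 ≤ 11/60 ≤ cap2 S` at every `S ⊆ G` with `|S ∖ K| ≥ 8`.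
-/

namespace PercRepro.Shadow

open Finset PerFlat ThmH

variable {α : Type*} [DecidableEq α] {M : Matroid α} [M.Finite]

section CommonLine

variable {G : Finset α}

/-- `S ∖ B` avoids the coloops for a source `B` of `S`. -/
theorem sdiff_disjoint_coloops_of_source (hG : G ∈ flatsQ M (5 + 1)) (hd : (gr M \ G).card ≤ 5)
    {P : Finset α → Prop} [DecidablePred P] {S B : Finset α} (hB : B ∈ missedSources M 5 G P S) :
    Disjoint (S \ B) (coloops M G) := by
  have hK : coloops M G ⊆ B := coloops_subset_of_mem_thinMembers hG hd (mem_missedSources.1 hB).1.1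
  rw [Finset.disjoint_left]
  intro a ha haK
  exact (Finset.mem_sdiff.1 ha).2 (hK haK)

open scoped Classical in
/-- **Three distinct sources of a large target are nested: `B ∩ B' ⊆ B''`** (cell `(3, 2)`, `|S ∖ K| ≥ 8`): the
sets `(B ∩ B') ∖ K` and `(B ∩ B'') ∖ K` have rank `≤ 2` and share `≥ |S ∖ K| − 6 ≥ 2` points, so the first lies in
`cl B''`, whose trace on `S` is `B''`. -/
theorem inter_subset_of_sources (hG : G ∈ flatsQ M (5 + 1)) (hd : (gr M \ G).card ≤ 5) (hk : kColoops M G = 2)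
    (hs : ∀ e ∈ gr M, ∀ f ∈ gr M, e ≠ f → rkN M {e, f} = 2) {P : Finset α → Prop} [DecidablePred P]
    {S : Finset α} (h8 : 8 ≤ (S \ coloops M G).card) {B B' B'' : Finset α}
    (hB : B ∈ missedSources M 5 G P S) (hB' : B' ∈ missedSources M 5 G P S)
    (hB'' : B'' ∈ missedSources M 5 G P S) (h1 : B ≠ B') :
    B ∩ B' ⊆ B'' := by
  have hGg : G ⊆ gr M := (mem_flatsQ.1 hG).1
  have hthin : B ∈ thinMembers M 5 G := (mem_missedSources.1 hB).1.1
  have hBU : B ∈ Uq M (5 + 2) 5 := (mem_membersIn.1 (mem_thinMembers.1 hthin).1).1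
  have hBG : B ⊆ G := (subset_clF hBU).trans (mem_membersIn.1 (mem_thinMembers.1 hthin).1).2
  have hK'' : coloops M G ⊆ B'' := coloops_subset_of_mem_thinMembers hG hd (mem_missedSources.1 hB'').1.1
  have hBS : B ⊆ S := (mem_missedSources.1 hB).2.1
  have hB'S : B' ⊆ S := (mem_missedSources.1 hB').2.1
  have hB''S : B'' ⊆ S := (mem_missedSources.1 hB'').2.1
  set R := (B ∩ B') \ coloops M G with hR
  set R' := (B ∩ B'') \ coloops M G with hR'
  have hRr : rkN M R ≤ 2 := rkN_inter_sdiff_coloops_le_two_of_sources hG hd hk hB hB' h1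
  have hRg : R ⊆ gr M := fun a ha => hGg (hBG (Finset.mem_inter.1 (Finset.mem_sdiff.1 ha).1).1)
  -- `R ∩ R'` contains `(S ∖ K)` minus the three pairs `S ∖ B`, `S ∖ B'`, `S ∖ B''`
  have hcard : 2 ≤ (R ∩ R').card := by
    have hsub : (((S \ coloops M G) \ (S \ B)) \ (S \ B')) \ (S \ B'') ⊆ R ∩ R' := by
      intro a ha
      simp only [Finset.mem_sdiff, not_and, not_not] at ha
      obtain ⟨⟨⟨⟨haS, haK⟩, haB⟩, haB'⟩, haB''⟩ := ha
      simp only [hR, hR', Finset.mem_inter, Finset.mem_sdiff]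
      exact ⟨⟨⟨haB haS, haB' haS⟩, haK⟩, ⟨haB haS, haB'' haS⟩, haK⟩
    have h1c := Finset.card_le_card hsub
    have e1 := Finset.le_card_sdiff (S \ B) (S \ coloops M G)
    have e2 := Finset.le_card_sdiff (S \ B') ((S \ coloops M G) \ (S \ B))
    have e3 := Finset.le_card_sdiff (S \ B'') (((S \ coloops M G) \ (S \ B)) \ (S \ B'))
    have c1 : (S \ B).card = 2 := (mem_missedSources.1 hB).2.2.1
    have c2 : (S \ B').card = 2 := (mem_missedSources.1 hB').2.2.1
    have c3 : (S \ B'').card = 2 := (mem_missedSources.1 hB'').2.2.1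
    omega
  -- hence `R ⊆ cl (R ∩ R') ⊆ cl R' ⊆ cl B''`
  have hRcl : R ⊆ clF M (R ∩ R') := subset_clF_inter_of_rkN_le_two hs hRg hRr hcard
  have hmono : clF M (R ∩ R') ⊆ clF M B'' := by
    rw [← Finset.coe_subset, coe_clF, coe_clF]
    apply M.closure_subset_closure
    intro a ha
    rw [Finset.mem_coe] at ha ⊢
    exact (Finset.mem_inter.1 (Finset.mem_sdiff.1 (Finset.mem_inter.1 ha).2).1).2
  -- `B ∩ B' ⊆ cl B''` (the coloops through `K ⊆ B''`), and `S ∩ cl B'' = B''`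
  intro a ha
  have haS : a ∈ S := hBS (Finset.mem_inter.1 ha).1
  have hacl : a ∈ clF M B'' := by
    by_cases haK : a ∈ coloops M G
    · exact subset_clF (mem_membersIn.1 (mem_thinMembers.1 (mem_missedSources.1 hB'').1.1).1).1 (hK'' haK)
    · exact hmono (hRcl (Finset.mem_sdiff.2 ⟨ha, haK⟩))
  have := source_eq_inter_clF hB''
  rw [this]
  exact Finset.mem_inter.2 ⟨haS, hacl⟩

/-- **A family of co-pairs of `S` in which any three members satisfy `B ∩ B' ⊆ B''` has at most three members.** -/
theorem card_le_three_of_inter_subset {S : Finset α} {𝓑 : Finset (Finset α)} (hsub : ∀ B ∈ 𝓑, B ⊆ S)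
    (hc : ∀ B ∈ 𝓑, (S \ B).card = 2)
    (hnest : ∀ B ∈ 𝓑, ∀ B' ∈ 𝓑, ∀ B'' ∈ 𝓑, B ≠ B' → B ≠ B'' → B ∩ B' ⊆ B'') : 𝓑.card ≤ 3 := by
  -- the map `B ↦ S ∖ B` is injective on `𝓑`
  have hinj : ∀ B ∈ 𝓑, ∀ B' ∈ 𝓑, S \ B = S \ B' → B = B' := by
    intro B hB B' hB' h
    rw [← Finset.sdiff_sdiff_eq_self (hsub B hB), ← Finset.sdiff_sdiff_eq_self (hsub B' hB'), h]
  by_contra hlt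
  push Not at hlt
  obtain ⟨B₁, hB₁⟩ : 𝓑.Nonempty := Finset.card_pos.1 (by omega)
  have hc1 : 2 < (𝓑.erase B₁).card := by rw [Finset.card_erase_of_mem hB₁]; omega
  obtain ⟨B₂, hB₂'⟩ : (𝓑.erase B₁).Nonempty := Finset.card_pos.1 (by omega)
  have hB₂ : B₂ ∈ 𝓑 := Finset.mem_of_mem_erase hB₂'
  have h12 : B₂ ≠ B₁ := Finset.ne_of_mem_erase hB₂'
  set U := (S \ B₁) ∪ (S \ B₂) with hU
  -- every member's co-pair lies in `U`
  have hinU : ∀ B ∈ 𝓑, S \ B ⊆ U := by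
    intro B hB
    by_cases hb1 : B = B₁
    · rw [hb1]; exact Finset.subset_union_left
    by_cases hb2 : B = B₂
    · rw [hb2]; exact Finset.subset_union_right
    have := hnest B₁ hB₁ B₂ hB₂ B hB (Ne.symm h12) (Ne.symm hb1)
    intro a ha
    rw [Finset.mem_sdiff] at ha
    rw [hU, Finset.mem_union, Finset.mem_sdiff, Finset.mem_sdiff]
    by_contra hcon
    push Not at hcon
    exact ha.2 (this (Finset.mem_inter.2 ⟨hcon.1 ha.1, hcon.2 ha.1⟩))
  by_cases hdisj : Disjoint (S \ B₁) (S \ B₂)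
  · -- the family is `{B₁, B₂}`
    have h3 : 3 ≤ 𝓑.card := by omega
    have hc2 : 1 < ((𝓑.erase B₁).erase B₂).card := by
      rw [Finset.card_erase_of_mem hB₂', Finset.card_erase_of_mem hB₁]; omega
    obtain ⟨B₃, hB₃'⟩ : ((𝓑.erase B₁).erase B₂).Nonempty := Finset.card_pos.1 (by omega)
    have hB₃ : B₃ ∈ 𝓑 := Finset.mem_of_mem_erase (Finset.mem_of_mem_erase hB₃')
    have h32 : B₃ ≠ B₂ := Finset.ne_of_mem_erase hB₃'
    have h31 : B₃ ≠ B₁ := Finset.ne_of_mem_erase (Finset.mem_of_mem_erase hB₃')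
    -- `B₂ ∩ B₃ ⊆ B₁`, i.e. `S ∖ B₁ ⊆ (S ∖ B₂) ∪ (S ∖ B₃)`; disjointness gives `S ∖ B₁ ⊆ S ∖ B₃`
    have hn := hnest B₂ hB₂ B₃ hB₃ B₁ hB₁ (Ne.symm h32) h12
    have hsub13 : S \ B₁ ⊆ S \ B₃ := by
      intro a ha
      rw [Finset.mem_sdiff] at ha ⊢
      refine ⟨ha.1, fun haB₃ => ?_⟩
      have haB₂ : a ∈ B₂ := by
        by_contra haB₂
        exact Finset.disjoint_left.1 hdisj (Finset.mem_sdiff.2 ha) (Finset.mem_sdiff.2 ⟨ha.1, haB₂⟩)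
      exact ha.2 (hn (Finset.mem_inter.2 ⟨haB₂, haB₃⟩))
    have heq : S \ B₁ = S \ B₃ := Finset.eq_of_subset_of_card_le hsub13 (by rw [hc B₁ hB₁, hc B₃ hB₃])
    exact h31 (hinj B₃ hB₃ B₁ hB₁ heq.symm)
  · -- `|U| ≤ 3`: the co-pairs are distinct `2`-subsets of `U`
    have hU3 : U.card ≤ 3 := by
      have hui := Finset.card_union_add_card_inter (S \ B₁) (S \ B₂)
      have hpos : 0 < ((S \ B₁) ∩ (S \ B₂)).card := by
        rw [Finset.card_pos, Finset.nonempty_iff_ne_empty]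
        intro h
        exact hdisj (Finset.disjoint_iff_inter_eq_empty.2 h)
      rw [hc B₁ hB₁, hc B₂ hB₂, ← hU] at hui
      omega
    have himg : 𝓑.image (fun B => S \ B) ⊆ U.powersetCard 2 := by
      intro π hπ
      rw [Finset.mem_image] at hπ
      obtain ⟨B, hB, rfl⟩ := hπ
      rw [Finset.mem_powersetCard]
      exact ⟨hinU B hB, hc B hB⟩
    have hcardimg : (𝓑.image (fun B => S \ B)).card = 𝓑.card := by
      rw [Finset.card_image_of_injOn]
      intro B hB B' hB' h
      exact hinj B hB B' hB' h
    have := Finset.card_le_card himg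
    rw [hcardimg, Finset.card_powersetCard] at this
    have hch : U.card.choose 2 ≤ 3 := by
      have : U.card ≤ 3 := hU3
      interval_cases U.card <;> norm_num [Nat.choose]
    omega

open scoped Classical in
/-- **At most three sources at a large target** (cell `(3, 2)`, `|S ∖ K| ≥ 8`). -/
theorem card_missedSources_le_three (hG : G ∈ flatsQ M (5 + 1)) (hd : (gr M \ G).card ≤ 5) (hk : kColoops M G = 2)
    (hs : ∀ e ∈ gr M, ∀ f ∈ gr M, e ≠ f → rkN M {e, f} = 2) {P : Finset α → Prop} [DecidablePred P]
    {S : Finset α} (h8 : 8 ≤ (S \ coloops M G).card) : (missedSources M 5 G P S).card ≤ 3 :=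
  card_le_three_of_inter_subset (fun _ hB => (mem_missedSources.1 hB).2.1)
    (fun _ hB => (mem_missedSources.1 hB).2.2.1)
    (fun _ hB _ hB' _ hB'' h1 _ => inter_subset_of_sources hG hd hk hs h8 hB hB' hB'' h1)

end CommonLine

section Column

variable {G : Finset α}

open scoped Classical in
/-- **THE COLUMN BOUND OF THE MISSED-POINT ROUTING AT THE LARGE TARGETS** (cell `(3, 2)`): at every set `S ⊆ G`
with `|S ∖ K| ≥ 8` (shadow set or not), `dload S ≤ cap2 S` for the big members routed by `dshMissed`. -/
theorem dload_missed_le_cap2_of_eight_le (hG : G ∈ flatsQ M (5 + 1)) (hd : (gr M \ G).card = 3)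
    (hk : kColoops M G = 2) (hs : ∀ e ∈ gr M, ∀ f ∈ gr M, e ≠ f → rkN M {e, f} = 2)
    (hl : ∀ e ∈ gr M, M.Indep {e}) {P : Finset α → Prop} [DecidablePred P]
    (hP : ∀ B, P B → 4 ≤ (B \ coloops M G).card) {S : Finset α} (h8 : 8 ≤ (S \ coloops M G).card) :
    dload M 5 G P (dshMissed M 5 G) S ≤ cap2 M 5 G S := by
  have hd' : (gr M \ G).card ≤ 5 := by omega
  have hle := dload_missed_le_card_sources_three_two hG hd hk hs hl hP S
  by_cases hne : (missedSources M 5 G P S).Nonempty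
  · obtain ⟨B, hB⟩ := hne
    obtain ⟨⟨hthin, hPB⟩, hBS, hc2, hsub⟩ := mem_missedSources.1 hB
    obtain ⟨z, x, hzx, hzx'⟩ := Finset.card_eq_two.1 hc2
    have hz : z ∈ G \ clF M B := hsub (by rw [hzx']; exact Finset.mem_insert_self _ _)
    have hx : x ∈ G \ clF M B := hsub (by rw [hzx']; exact Finset.mem_insert_of_mem (Finset.mem_singleton_self _))
    have hSeq : S = insert x (insert z B) := by
      ext a
      constructor
      · intro ha
        by_cases haB : a ∈ B
        · exact Finset.mem_insert_of_mem (Finset.mem_insert_of_mem haB)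
        · have : a ∈ S \ B := Finset.mem_sdiff.2 ⟨ha, haB⟩
          rw [hzx', Finset.mem_insert, Finset.mem_singleton] at this
          rcases this with rfl | rfl
          · exact Finset.mem_insert_of_mem (Finset.mem_insert_self _ _)
          · exact Finset.mem_insert_self _ _
      · intro ha
        rw [Finset.mem_insert, Finset.mem_insert] at ha
        rcases ha with rfl | rfl | haB
        · exact (Finset.mem_sdiff.1 (by rw [hzx']; exact Finset.mem_insert_of_mem (Finset.mem_singleton_self _) :
            a ∈ S \ B)).1
        · exact (Finset.mem_sdiff.1 (by rw [hzx']; exact Finset.mem_insert_self _ _ : a ∈ S \ B)).1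
        · exact hBS haB
    have hcap : (11 / 60 : ℚ) ≤ cap2 M 5 G S := by
      rw [hSeq]
      exact cap2_ge_of_missed_three_two hG hd hk hs hthin (hP B hPB) hz hx hzx
    have h3 := card_missedSources_le_three hG hd' hk hs (P := P) h8
    have h3' : ((missedSources M 5 G P S).card : ℚ) ≤ 3 := by exact_mod_cast h3
    linarith
  · rw [Finset.not_nonempty_iff_eq_empty] at hne
    rw [hne, Finset.card_empty] at hle
    have := cap2_nonneg (capS_nonneg' hG hd' S)
    linarith

end Column

end PercRepro.Shadow
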